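import Summits.MatrixMultiplication.MatrixMultiplication.Theorems.SoloBlindHSharp

/-!
# The top layer: a full sumset of `S·σ` makes every colouring good, so H♯ ⟺ E there

Sub-programme (K₃), Conjecture H♯ (`soloBlindHSharp`).  Write `Σ⁰(S) = {Σ_V h : V ⊆ S}`.  Call the pair
`(S, σ)` FULL (`soloBlindFull h S σ`) when every `g : G` is `Σ_V h` or `σ + Σ_V h` for some `V ⊆ S`, i.e.
`Σ⁰(S) ∪ (σ + Σ⁰(S)) = G` — the sumset of the extended family `S·σ` is everything.

* `soloBlind_full_of_maximal` — FULL follows from MAXIMALITY: `S·σ` is zero-sum free as a family (`S` is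
  zero-sum free and `σ + Σ_V h ≠ 0` for all `V ⊆ S`, the latter being H-goodness `2σ ∉ Σ⁰(S)` in exponent 3)
  and no one-element extension `S·σ·g` is.  By Olson's theorem `D(𝔽₃^r) = 2r + 1` this is automatic when
  `S ⊆ 𝔽₃^r` is zero-sum free with `|S| = 2r - 1` and `σ` is H-good: the TOP LAYER, one below the maximal
  size `2r`, where no H-good target exists at all (`Σ(S) = G ∖ {0}` forces `2σ ∈ Σ(S)`).
* `soloBlind_thick_of_full` — in exponent 3, FULL says that for every `u` one of `u - σ`, `u + σ` is in
  `Σ⁰(S)`: every affine line parallel to `σ` carries at least two subset sums (at `u = 0`: `σ` or `-σ` is a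
  subset sum — applied to a hole `g ∉ Σ⁰(S)` with `-g ∉ Σ⁰(S)`, for which `S·g` is again zero-sum free, this is
  the CO-SYMMETRY of the top layer, `Σ⁰(S) ∪ -Σ⁰(S) = G`, so that the H-good targets there are exactly the
  negatives of the holes).
* `soloBlind_allGood_of_full` — THE TOP-LAYER THEOREM: in exponent 3, FULL makes EVERY 2-colouring `U ⊆ S`
  good (`σ + Σ_U h ∈ Σ⁰(S)` or `σ + Σ_{S \ U} h ∈ Σ⁰(S)`); the second alternative comes from complementation
  `Σ_{S \ V} = Σ_S - Σ_V`.
* `soloBlind_hsharp_iff_conjE_of_full` — consequently on the top layer Conjecture H♯ at `(S, σ)` is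
  EQUIVALENT to Conjecture E there (`K(σ; S) ≤ 1/2`): the strengthening H♯ costs nothing exactly where E is
  tight — every E-tight instance found so far (the binary lifts `S_m`, `m ≡ 0 (mod 3)`, the closed
  counterexample `P°⁺` to locality, the 826 tight classes of the 5- and 6-vertex censuses) lives on the top
  layer `|S| = 2·rank - 1`.
Numerically (s82): all `2^{|S|}` colourings are good for every H-good target of every zero-sum-free spanning
`S ⊆ 𝔽₃^r` with `|S| = 2r - 1` — exhaustively for `r ≤ 3` (73 056 targets) and for ≈ 3.6·10⁶ sampled targets
in ranks 4–6 — while at `|S| = 2r - 2` most targets have bad colourings.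
-/

namespace Summit.MatrixMultiplication.MatrixMultiplication.Theorems

open Finset

universe u v

variable {ι : Type v} [DecidableEq ι]
variable {G : Type u} [AddCommGroup G]

/-- FULL: every element of `G` is a subset sum of `S` or `σ` plus a subset sum of `S`
(`Σ⁰(S) ∪ (σ + Σ⁰(S)) = G`, the sumset of the extended family `S·σ` together with `0`). -/
def soloBlindFull (h : ι → G) (S : Finset ι) (σ : G) : Prop :=
  ∀ g : G, ∃ V ⊆ S, ∑ i ∈ V, h i = g ∨ σ + ∑ i ∈ V, h i = g

omit [DecidableEq ι] in
/-- MAXIMALITY GIVES FULLNESS: if the family `S·σ` is zero-sum free (`S` zero-sum free and `σ + Σ_V h ≠ 0` for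
all `V ⊆ S`) and every one-element extension `S·σ·g` has a zero sub-sum, then `(S, σ)` is FULL.  (For
`S ⊆ 𝔽₃^r` zero-sum free with `|S| = 2r - 1` the last hypothesis is Olson's `D(𝔽₃^r) = 2r + 1`.) -/
theorem soloBlind_full_of_maximal {h : ι → G} {S : Finset ι} {σ : G}
    (zsf : ∀ T ⊆ S, T.Nonempty → ∑ i ∈ T, h i ≠ 0) (hσ : ∀ T ⊆ S, σ + ∑ i ∈ T, h i ≠ 0)
    (hmax : ∀ g : G, ∃ V ⊆ S, (V.Nonempty ∧ ∑ i ∈ V, h i = 0) ∨ σ + ∑ i ∈ V, h i = 0 ∨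
      -g + ∑ i ∈ V, h i = 0 ∨ -g + σ + ∑ i ∈ V, h i = 0) :
    soloBlindFull h S σ := by
  intro g
  obtain ⟨V, hV, hcase⟩ := hmax g
  rcases hcase with ⟨hne, h0⟩ | h0 | h0 | h0
  · exact absurd h0 (zsf V hV hne)
  · exact absurd h0 (hσ V hV)
  · rw [neg_add_eq_zero] at h0
    exact ⟨V, hV, Or.inl h0.symm⟩
  · rw [add_assoc, neg_add_eq_zero] at h0
    exact ⟨V, hV, Or.inr h0.symm⟩

omit [DecidableEq ι] in
/-- THICKNESS: in exponent 3 a FULL pair has, for every `u`, one of `u - σ`, `u + σ` among the subset sums of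
`S` — every affine line parallel to `σ` contains at least two points of `Σ⁰(S)`. -/
theorem soloBlind_thick_of_full {h : ι → G} {S : Finset ι} {σ : G} (three : ∀ g : G, g + g + g = 0)
    (hfull : soloBlindFull h S σ) (u : G) :
    (∃ V ⊆ S, ∑ i ∈ V, h i = u - σ) ∨ (∃ V ⊆ S, ∑ i ∈ V, h i = u + σ) := by
  obtain ⟨V, hV, hcase⟩ := hfull (u - σ)
  rcases hcase with h1 | h2
  · exact Or.inl ⟨V, hV, h1⟩
  · refine Or.inr ⟨V, hV, ?_⟩
    have e : ∑ i ∈ V, h i = u - σ - σ := by rw [← h2]; abel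
    calc ∑ i ∈ V, h i = u - σ - σ + (σ + σ + σ) := by rw [e, three σ, add_zero]
      _ = u + σ := by abel

variable [DecidableEq G]

/-- THE TOP-LAYER THEOREM: in exponent 3 a FULL pair `(S, σ)` has EVERY colouring `U ⊆ S` good. -/
theorem soloBlind_allGood_of_full {h : ι → G} {S : Finset ι} {σ : G} (three : ∀ g : G, g + g + g = 0)
    (hfull : soloBlindFull h S σ) {U : Finset ι} (hU : U ⊆ S) :
    U ∈ soloBlindGoodColourings h S σ := by
  rw [soloBlind_mem_goodColourings]
  refine ⟨hU, ?_⟩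
  rcases soloBlind_thick_of_full three hfull (∑ i ∈ U, h i) with ⟨V, hV, h1⟩ | ⟨V, hV, h2⟩
  · -- `Σ_V = Σ_U - σ`: the complement `S \ V` sums to `σ + Σ_{S \ U}`.
    refine Or.inr ⟨S \ V, sdiff_subset, ?_⟩
    have eV : ∑ i ∈ S \ V, h i = ∑ i ∈ S, h i - ∑ i ∈ V, h i := eq_sub_of_add_eq (sum_sdiff hV)
    have eU : ∑ i ∈ S \ U, h i = ∑ i ∈ S, h i - ∑ i ∈ U, h i := eq_sub_of_add_eq (sum_sdiff hU)
    rw [eV, eU, h1]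
    abel
  · -- `Σ_V = Σ_U + σ = σ + Σ_U`.
    refine Or.inl ⟨V, hV, ?_⟩
    rw [h2, add_comm]

/-- On a FULL pair every colouring is good: the good colourings are the whole power set. -/
theorem soloBlind_goodColourings_eq_powerset_of_full {h : ι → G} {S : Finset ι} {σ : G}
    (three : ∀ g : G, g + g + g = 0) (hfull : soloBlindFull h S σ) :
    soloBlindGoodColourings h S σ = S.powerset := by
  ext U
  constructor
  · intro hU
    exact mem_powerset.mpr (soloBlind_mem_goodColourings.mp hU).1
  · intro hU
    exact soloBlind_allGood_of_full three hfull (mem_powerset.mp hU)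

/-- H♯ ⟺ E ON THE TOP LAYER: for a FULL pair in exponent 3, Conjecture H♯ at `(S, σ)` holds iff
`K(σ; S) ≤ 1/2`. -/
theorem soloBlind_hsharp_iff_conjE_of_full {h : ι → G} {S : Finset ι} {σ : G}
    (three : ∀ g : G, g + g + g = 0) (hfull : soloBlindFull h S σ) :
    soloBlindHSharp h S σ ↔ soloBlindMass h S σ ≤ 1 / 2 := by
  constructor
  · exact soloBlind_conjE_of_hsharp
  · intro hE
    unfold soloBlindHSharp
    rw [soloBlind_incidence_eq_mass, soloBlind_goodColourings_eq_powerset_of_full three hfull,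
      card_powerset]
    push_cast
    have hpos : (0 : ℚ) ≤ 2 ^ S.card := by positivity
    have h1 := mul_le_mul_of_nonneg_left hE hpos
    rw [pow_succ]
    linarith

end Summit.MatrixMultiplication.MatrixMultiplication.Theorems
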